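import Summits.AtomisticToContinuum.Crystallization.Theorems.FrustratedLawDichotomyStrainedPatchShearDoorA

/-!
# ShearDoor — part 2 of 2 (sequel of `…FrustratedLawDichotomyStrainedPatchShearDoorA`)

Split for the 400-line cap by the landing lane (hand-2 g42); the module docstring of part 1 (`…FrustratedLawDichotomyStrainedPatchShearDoorA`) describes the whole node.  Same namespace; all FQNs unchanged.
0 sorry; standard axioms.
-/

open scoped BigOperators Classical RealInnerProductSpace
open Summit.AtomisticToContinuum.Crystallization.Theorems.ChargedEnergyGapNegative (eStar E3)
open Summit.AtomisticToContinuum.Crystallization.Theorems.FrustratedLawDichotomyRangeCut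
open Summit.AtomisticToContinuum.Crystallization.Theorems.FrustratedLawDichotomySchurCut
open Summit.AtomisticToContinuum.Crystallization.Theorems.FrustratedLawDichotomyMotifLemmas (GoodAtScale)
open Summit.AtomisticToContinuum.Crystallization.Theorems.FrustratedLawDichotomyAveragingCut (ballAvg)
open Summit.AtomisticToContinuum.Crystallization.Theorems.FrustratedLawDichotomyExemptLocOpt (LocOptFails)
open Summit.AtomisticToContinuum.Crystallization.Theorems.FrustratedLawDichotomyExemptSplit (SchurElasticPricingX)
open Summit.AtomisticToContinuum.Crystallization.Theorems.FrustratedLawDichotomyExemptAbsorptionRecord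
open Summit.AtomisticToContinuum.Crystallization.Theorems.FrustratedLawDichotomyCollarCensus
open Summit.AtomisticToContinuum.Crystallization.Theorems.FrustratedLawDichotomyCollarCensusKappa
open Summit.AtomisticToContinuum.Crystallization.Theorems.FrustratedLawDichotomyStrainedPatchHomSplit
open Summit.AtomisticToContinuum.Crystallization.Theorems.FrustratedLawDichotomyStrainedPatchCleanCollar (CleanBall TailPenalty AnnularDefectFloor
  DefectiveCollarFloor tailOut)
open Summit.AtomisticToContinuum.Crystallization.Theorems.FrustratedLawDichotomyStrainedPatchPhaseCut (MonoPhaseBall AnnularPhaseFloor PolyTextureFloor)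
open Summit.AtomisticToContinuum.Crystallization.Theorems.FrustratedLawDichotomyStrainedPatchCoreTube (NearHomIsoAt CoreOffTubeFloor)
open Summit.AtomisticToContinuum.Crystallization.Theorems.FrustratedLawDichotomyStrainedPatchCoreTubeRecord (CoreCoreRelief)
open Summit.AtomisticToContinuum.Crystallization.Theorems.FrustratedLawDichotomyStrainedPatchChartFamilies (ChartBy FamilyLE familyLE_refl)
open Summit.AtomisticToContinuum.Crystallization.Theorems.FrustratedLawDichotomyStrainedPatchChartFamiliesBent (IsBentBall)
open Summit.AtomisticToContinuum.Crystallization.Theorems.FrustratedLawDichotomyStrainedPatchChartFamiliesPinned (bends0)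
open Summit.AtomisticToContinuum.Crystallization.Theorems.FrustratedLawDichotomyStrainedPatchQuantSlaving
open Summit.AtomisticToContinuum.Crystallization.Theorems.FrustratedLawDichotomyStrainedPatchHostCells (TubeFloor FamP)
open Summit.AtomisticToContinuum.Crystallization.Theorems.FrustratedLawDichotomyStrainedPatchGradedTube
open Summit.AtomisticToContinuum.Crystallization.Theorems.FrustratedLawDichotomyStrainedPatchCoverBridge
open Summit.AtomisticToContinuum.Crystallization.Theorems.FrustratedLawDichotomyStrainedPatchPairTube
open Summit.AtomisticToContinuum.Crystallization.Theorems.FrustratedLawDichotomyStrainedPatchKernelCut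
open Summit.AtomisticToContinuum.Crystallization.Theorems.FrustratedLawDichotomyStrainedPatchHomCertTree (CertTree treeOK)
open Summit.AtomisticToContinuum.Crystallization.Theorems.FrustratedLawDichotomyStrainedPatchHomEntryGram (rootC rootW)
open Summit.AtomisticToContinuum.Crystallization.Theorems.FrustratedLawDichotomyStrainedPatchHomEntryGramHcp (rootCH rootWH)
open Summit.AtomisticToContinuum.Crystallization.Theorems.FrustratedLawDichotomyStrainedPatchHomEntryLeafHT (entryLeafOK6RBKP4 semOKH)
open Summit.AtomisticToContinuum.Crystallization.Theorems.FrustratedLawDichotomyAperiodicGapRecordJunctionHomFloorF6pT26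
open Summit.AtomisticToContinuum.Crystallization.Theorems.FrustratedLawDichotomyStrainedPatchConeAnatomy
open Summit.AtomisticToContinuum.Crystallization.Theorems.FrustratedLawDichotomyStrainedPatchStiffSector
open Summit.AtomisticToContinuum.Crystallization.Theorems.FrustratedLawDichotomyStrainedPatchStiffDoor
open Summit.AtomisticToContinuum.Crystallization.Theorems.FrustratedLawDichotomyStrainedPatchKernelCutSector

namespace Summit.AtomisticToContinuum.Crystallization.Theorems.FrustratedLawDichotomyStrainedPatchShearDoor

/-! ## §2. The FOUR-SECTOR cut: the band 𝔅 = dense ∧ ¬𝓡 re-dialled at a density threshold `dB` (generic functionals throughout) -/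

section FourSector

variable {𝓘₀ 𝓗 𝓘 𝓡 : ChartFam} {dA dB ρ ε η₂ τ₀ τ RE : ℝ} {T₀ T : SlackTab} {B : PairTab}
  {βf₁ βf₂ βf₃ sf₁ sf₂ sf₃ : (M₀ : ℕ) → (Fin M₀ → E3) → Fin M₀ → ℝ}

/-- ★ (N|𝔅) ⟸ (N|𝔅lo) ∧ (N|𝔅hi) at ONE common table (the table is read at the hull host: `refineGB_of_two_sectors` with `𝓟 := Dense dB`); each piece
strictly weaker (`refineGB_iff_two_sectors`). [formal bookkeeping] -/
theorem refineGB_band_of_two (hlo : RefineGB (famAnd (famAndNot (famAnd 𝓘₀ (Dense dA)) 𝓡) (Dense dB)) 𝓗 ρ ε η₂ τ₀ T₀ τ T B)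
    (hhi : RefineGB (famAndNot (famAndNot (famAnd 𝓘₀ (Dense dA)) 𝓡) (Dense dB)) 𝓗 ρ ε η₂ τ₀ T₀ τ T B) :
    RefineGB (famAndNot (famAnd 𝓘₀ (Dense dA)) 𝓡) 𝓗 ρ ε η₂ τ₀ T₀ τ T B :=
  refineGB_of_two_sectors hlo hhi

/-- ★ (E|𝔅) at the band's glued functionals ⟸ (E|𝔅lo) at cone 2 ∧ (E|𝔅hi) at cone 3 (`tubeFloorGB_relConeBy_stepF` with `𝓟 := Dense dB`). [formal bookkeeping] -/
theorem tubeFloorGB_band_of_two (hlo : TubeFloorGB (famAnd (famAndNot (famAnd 𝓘 (Dense dA)) 𝓡) (Dense dB)) τ T (relConeBy RE βf₂ sf₂ τ₀))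
    (hhi : TubeFloorGB (famAndNot (famAndNot (famAnd 𝓘 (Dense dA)) 𝓡) (Dense dB)) τ T (relConeBy RE βf₃ sf₃ τ₀)) :
    TubeFloorGB (famAndNot (famAnd 𝓘 (Dense dA)) 𝓡) τ T (relConeBy RE (stepByF (Dense dB) βf₂ βf₃) (stepByF (Dense dB) sf₂ sf₃) τ₀) :=
  tubeFloorGB_relConeBy_stepF hlo hhi

/-- EXACTNESS of the band split on the E-side: the glued band cell gives back (E|𝔅lo) at its own cone … [formal bookkeeping] -/
theorem tubeFloorGB_bandLo_of_band
    (h : TubeFloorGB (famAndNot (famAnd 𝓘 (Dense dA)) 𝓡) τ T (relConeBy RE (stepByF (Dense dB) βf₂ βf₃) (stepByF (Dense dB) sf₂ sf₃) τ₀)) :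
    TubeFloorGB (famAnd (famAndNot (famAnd 𝓘 (Dense dA)) 𝓡) (Dense dB)) τ T (relConeBy RE βf₂ sf₂ τ₀) := by
  intro M z c M₀ z₀ c₀ e hz hcl hm hch
  have hp : Dense dB M₀ z₀ c₀ := (chartByG_mem hch.chartByG).2
  refine h M z c M₀ z₀ c₀ e hz hcl hm ((hch.mono_family famAnd_le).congr_pair fun a b => ?_)
  simp only [relConeBy, stepByF_of_pos hp]

/-- … and (E|𝔅hi) at its own cone. [formal bookkeeping] -/
theorem tubeFloorGB_bandHi_of_band
    (h : TubeFloorGB (famAndNot (famAnd 𝓘 (Dense dA)) 𝓡) τ T (relConeBy RE (stepByF (Dense dB) βf₂ βf₃) (stepByF (Dense dB) sf₂ sf₃) τ₀)) :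
    TubeFloorGB (famAndNot (famAndNot (famAnd 𝓘 (Dense dA)) 𝓡) (Dense dB)) τ T (relConeBy RE βf₃ sf₃ τ₀) := by
  intro M z c M₀ z₀ c₀ e hz hcl hm hch
  have hn : ¬Dense dB M₀ z₀ c₀ := (chartByG_mem hch.chartByG).2
  refine h M z c M₀ z₀ c₀ e hz hcl hm ((hch.mono_family famAndNot_le).congr_pair fun a b => ?_)
  simp only [relConeBy, stepByF_of_neg hn]

variable {𝓙 : ChartFam} {𝓑 : BalPred} {τ₁ κ σ : ℝ} {T₁ : SlackTab} {H : HessTab} {F : ForceTab} {X : SlackTab} {B' : PairTab}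

/-- A kernel-cut certificate only reads its table ON THE FAMILY'S HOSTS: tables agreeing there are interchangeable. [formal bookkeeping] -/
theorem pairKernelCert_congr_pair (hB : ∀ (M₀ : ℕ) (z₀ : Fin M₀ → E3) (c₀ : Fin M₀), 𝓙 M₀ z₀ c₀ → ∀ a b, B M₀ z₀ c₀ a b = B' M₀ z₀ c₀ a b)
    (h : PairKernelCert 𝓙 𝓑 τ₁ T₁ κ σ H F X τ T B) : PairKernelCert 𝓙 𝓑 τ₁ T₁ κ σ H F X τ T B' :=
  fun M z c M₀ z₀ c₀ e hch hb hin => (h M z c M₀ z₀ c₀ e hch hb hin).congr_pair (hB M₀ z₀ c₀ (chartByG_mem hch))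

/-- ★ On 𝔅lo hosts (`¬𝓡`, `Dense dB`) the four-sector dense-side functional `stepByF 𝓡 f₁ (stepByF (Dense dB) f₂ f₃)` IS `f₂`: the kernel-cut instrument run on
the low band at its own cone `(βf₂, sf₂)` certifies the cell at the glued table. [formal bookkeeping] -/
theorem pairKernelCert_bandLo_glued
    (h : PairKernelCert (famAnd (famAndNot (famAnd 𝓘₀ (Dense dA)) 𝓡) (Dense dB)) 𝓑 τ₁ T₁ κ σ H F X τ T (relConeBy RE βf₂ sf₂ τ₀)) :
    PairKernelCert (famAnd (famAndNot (famAnd 𝓘₀ (Dense dA)) 𝓡) (Dense dB)) 𝓑 τ₁ T₁ κ σ H F X τ T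
      (relConeBy RE (stepByF 𝓡 βf₁ (stepByF (Dense dB) βf₂ βf₃)) (stepByF 𝓡 sf₁ (stepByF (Dense dB) sf₂ sf₃)) τ₀) := by
  refine pairKernelCert_congr_pair (fun M₀ z₀ c₀ hm a b => ?_) h
  simp only [relConeBy, stepByF_of_neg hm.1.2, stepByF_of_pos hm.2]

/-- … and on 𝔅hi hosts (`¬𝓡`, `¬Dense dB`) it IS `f₃`. [formal bookkeeping] -/
theorem pairKernelCert_bandHi_glued
    (h : PairKernelCert (famAndNot (famAndNot (famAnd 𝓘₀ (Dense dA)) 𝓡) (Dense dB)) 𝓑 τ₁ T₁ κ σ H F X τ T (relConeBy RE βf₃ sf₃ τ₀)) :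
    PairKernelCert (famAndNot (famAndNot (famAnd 𝓘₀ (Dense dA)) 𝓡) (Dense dB)) 𝓑 τ₁ T₁ κ σ H F X τ T
      (relConeBy RE (stepByF 𝓡 βf₁ (stepByF (Dense dB) βf₂ βf₃)) (stepByF 𝓡 sf₁ (stepByF (Dense dB) sf₂ sf₃)) τ₀) := by
  refine pairKernelCert_congr_pair (fun M₀ z₀ c₀ hm a b => ?_) h
  simp only [relConeBy, stepByF_of_neg hm.1.2, stepByF_of_neg hm.2]

/-- ★★ **(N|𝔅lo) — INSTRUMENTED FORM** (identity refit, (E κ) ∧ (P₀ κ) at the record data on the low-band family, the certificate at the band's OWN cone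
`(βf₂, sf₂)`; hull `𝓗 ⊇ 𝔅lo`): the instrument r1589 (B) asks to NAME for `𝔅 ∩ {d < 1.009}` is the kernel-cut LP of «HTN-LP-96» run on low-band hosts.
[folklore instantiation] -/
theorem refineGB_NBlo_of_kernelCut_top (h𝓗 : FamilyLE (famAnd (famAndNot (famAnd 𝓘₀ (Dense dA)) 𝓡) (Dense dB)) 𝓗)
    (hE : SlavingEnclosureG (famAnd (famAndNot (famAnd 𝓘₀ (Dense dA)) 𝓡) (Dense dB)) balTop (26 / 5) (1 / 100) (1 / 8) (1 / 25) (constTol (1 / 25)) κ σ H F X)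
    (hP : PairKernelCert (famAnd (famAndNot (famAnd 𝓘₀ (Dense dA)) 𝓡) (Dense dB)) balTop (1 / 25) (constTol (1 / 25)) κ σ H F X (1 / 25) (constTol (1 / 25))
      (relConeBy 2 βf₂ sf₂ (1 / 25))) :
    RefineGB (famAnd (famAndNot (famAnd 𝓘₀ (Dense dA)) 𝓡) (Dense dB)) 𝓗 (26 / 5) (1 / 100) (1 / 8) (1 / 25) (constTol (1 / 25)) (1 / 25) (constTol (1 / 25))
      (relConeBy 2 (stepByF 𝓡 βf₁ (stepByF (Dense dB) βf₂ βf₃)) (stepByF 𝓡 sf₁ (stepByF (Dense dB) sf₂ sf₃)) (1 / 25)) :=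
  refineGB_of_kernelCut_top h𝓗 hE (pairKernelCert_bandLo_glued hP)

/-- ★★★ **`AperiodicFrustratedLawGap` FROM THE FOUR-SECTOR CELLS** — the three-sector consumer `…StiffDoor.aperiodicFrustratedLawGap_of_threeSector_A35000_T26_record`
with its band cells (E|𝔅), (N|𝔅) REPLACED by the low/high band pairs at the glued band functionals `stepByF (Dense dB) βf₂ βf₃` / `stepByF (Dense dB) sf₂ sf₃`
(every functional, `𝓡`, `dA`, `dB` generic).  Dense-side table: `relConeBy 2 (stepByF 𝓡 βf₁ (stepByF (Dense dB) βf₂ βf₃)) (stepByF 𝓡 sf₁ (stepByF (Dense dB) sf₂ sf₃)) (1/25)`.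
[folklore instantiation] -/
theorem aperiodicFrustratedLawGap_of_fourSector_A35000_T26_record {εE CE DE DX : ℝ}
    (hε0 : 0 < εE) (hε1 : εE ≤ 1 / 10000) (hDX : 0 ≤ DX)
    (hEl : SchurElasticPricingX (1 / 20) (1 / 8) w₄₅ ω₄ (3 / 400) (-(7175 / 10000)) (1 / 10000) CE DE DX (LocOptFails eStar εE (3 / 2) 1))
    (hFcc : ∃ t : CertTree (Fin 3 × Fin 3), treeOK (entryLeafOK6RBKP4 (-399210329969189)) t rootC rootW = true)
    (hHcp : semOKH (-399210329969189) rootCH rootWH = true)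
    (hT : ∀ (M : ℕ) (z : Fin M → E3) (c : Fin M), Admissible M z c → CleanBall (63 / 10) z c → MonoPhaseBall (63 / 10) z c →
      NearHomIsoAt (26 / 5) (1 / 100) z c → -(13 / 50000) ≤ ballAvg (9 / 5) z (tailOut (26 / 5) M z c) c)
    (hRl : CoreCoreRelief (63 / 10) (63 / 10) (26 / 5) (1 / 100) (3 / 5000))
    (hED : TubeFloorGB (famAnd (famAnd 𝓘 (Dense dA)) 𝓡) (1 / 25) (constTol (1 / 25)) (relConeBy 2 βf₁ sf₁ (1 / 25)))
    (hEBlo : TubeFloorGB (famAnd (famAndNot (famAnd 𝓘 (Dense dA)) 𝓡) (Dense dB)) (1 / 25) (constTol (1 / 25)) (relConeBy 2 βf₂ sf₂ (1 / 25)))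
    (hEBhi : TubeFloorGB (famAndNot (famAndNot (famAnd 𝓘 (Dense dA)) 𝓡) (Dense dB)) (1 / 25) (constTol (1 / 25)) (relConeBy 2 βf₃ sf₃ (1 / 25)))
    (hEA : TubeFloor (famAndNot 𝓘 (Dense dA)) (1 / 25))
    (hK : FamilyCoverGRecAt 𝓘₀ (26 / 5) (1 / 100))
    (hND : RefineGB (famAnd (famAnd 𝓘₀ (Dense dA)) 𝓡) 𝓗 (26 / 5) (1 / 100) (1 / 8) (1 / 25) (constTol (1 / 25)) (1 / 25) (constTol (1 / 25))
      (relConeBy 2 (stepByF 𝓡 βf₁ (stepByF (Dense dB) βf₂ βf₃)) (stepByF 𝓡 sf₁ (stepByF (Dense dB) sf₂ sf₃)) (1 / 25)))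
    (hNBlo : RefineGB (famAnd (famAndNot (famAnd 𝓘₀ (Dense dA)) 𝓡) (Dense dB)) 𝓗 (26 / 5) (1 / 100) (1 / 8) (1 / 25) (constTol (1 / 25)) (1 / 25)
      (constTol (1 / 25)) (relConeBy 2 (stepByF 𝓡 βf₁ (stepByF (Dense dB) βf₂ βf₃)) (stepByF 𝓡 sf₁ (stepByF (Dense dB) sf₂ sf₃)) (1 / 25)))
    (hNBhi : RefineGB (famAndNot (famAndNot (famAnd 𝓘₀ (Dense dA)) 𝓡) (Dense dB)) 𝓗 (26 / 5) (1 / 100) (1 / 8) (1 / 25) (constTol (1 / 25)) (1 / 25)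
      (constTol (1 / 25)) (relConeBy 2 (stepByF 𝓡 βf₁ (stepByF (Dense dB) βf₂ βf₃)) (stepByF 𝓡 sf₁ (stepByF (Dense dB) sf₂ sf₃)) (1 / 25)))
    (h𝓗 : FamilyLE (famAndNot 𝓘₀ (Dense dA)) 𝓗)
    (hcap : PairLE (relConeBy 2 (stepByF 𝓡 βf₁ (stepByF (Dense dB) βf₂ βf₃)) (stepByF 𝓡 sf₁ (stepByF (Dense dB) sf₂ sf₃)) (1 / 25)) (pairSum (constTol (1 / 25))))
    (h𝓘 : FamilyLE 𝓗 𝓘)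
    (hF : AnnularPhaseFloor (63 / 10) (24 / 5) (63 / 10) (1 / 1000)) (hP : PolyTextureFloor (63 / 10) (24 / 5) (1 / 1000))
    (hA : AnnularDefectFloor (24 / 5) (63 / 10)) (hD : DefectiveCollarFloor (24 / 5))
    (h2 : CrowdedCoreMotifPricingCapK (1 / 1000) (9 / 5) (133 / 10) (3 / 2) (effPot w₄₅ ω₄ (3 / 400)) (-(7175 / 10000) + 3 / 400)
      (Collar (9 / 2) fun N y j => (∃ s : ℝ, 0 ≤ s ∧ s ≤ 3 / 2 ∧ NonEquilibriumCore (-(7175 / 10000)) 0 7 s (1 / 10000) N y j) ∨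
        GoodAtScale (1 / 20) (3 / 2) y j))
    (h3 : DiluteDefectMotifPricingCapK (1 / 1000) (9 / 5) (133 / 10) (3 / 2) (effPot w₄₅ ω₄ (3 / 400)) (-(7175 / 10000) + 3 / 400)
      (Collar (9 / 2) fun N y j => (∃ s : ℝ, 0 ≤ s ∧ s ≤ 3 / 2 ∧ NonEquilibriumCore (-(7175 / 10000)) 0 7 s (1 / 10000) N y j) ∨
        GoodAtScale (1 / 20) (3 / 2) y j)) :
    Summit.AtomisticToContinuum.Crystallization.Theses.FrustratedLawDichotomy.AperiodicFrustratedLawGap :=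
  aperiodicFrustratedLawGap_of_threeSector_A35000_T26_record hε0 hε1 hDX hEl hFcc hHcp hT hRl hED (tubeFloorGB_band_of_two hEBlo hEBhi) hEA hK hND
    (refineGB_band_of_two hNBlo hNBhi) h𝓗 hcap h𝓘 hF hP hA hD h2 h3

/-- ★★★ … with (N|𝔇) AND (N|𝔅lo) in the INSTRUMENTED kernel-cut form (identity refit; (E κ) ∧ (P₀ κ) on each cell family at its own cone; hulls `𝓗 ⊇` the cells)
— the HTN-LP bundle certifies `hPD` on door hosts at `(βf₁, sf₁)` and `hPBlo` on low-band hosts at `(βf₂, sf₂)`. [folklore instantiation] -/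
theorem aperiodicFrustratedLawGap_of_fourSector_kernelCut_A35000_T26_record {εE CE DE DX κ κ' σ' : ℝ} {H' : HessTab} {F' : ForceTab} {X' : SlackTab}
    (hε0 : 0 < εE) (hε1 : εE ≤ 1 / 10000) (hDX : 0 ≤ DX)
    (hEl : SchurElasticPricingX (1 / 20) (1 / 8) w₄₅ ω₄ (3 / 400) (-(7175 / 10000)) (1 / 10000) CE DE DX (LocOptFails eStar εE (3 / 2) 1))
    (hFcc : ∃ t : CertTree (Fin 3 × Fin 3), treeOK (entryLeafOK6RBKP4 (-399210329969189)) t rootC rootW = true)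
    (hHcp : semOKH (-399210329969189) rootCH rootWH = true)
    (hT : ∀ (M : ℕ) (z : Fin M → E3) (c : Fin M), Admissible M z c → CleanBall (63 / 10) z c → MonoPhaseBall (63 / 10) z c →
      NearHomIsoAt (26 / 5) (1 / 100) z c → -(13 / 50000) ≤ ballAvg (9 / 5) z (tailOut (26 / 5) M z c) c)
    (hRl : CoreCoreRelief (63 / 10) (63 / 10) (26 / 5) (1 / 100) (3 / 5000))
    (hED : TubeFloorGB (famAnd (famAnd 𝓘 (Dense dA)) 𝓡) (1 / 25) (constTol (1 / 25)) (relConeBy 2 βf₁ sf₁ (1 / 25)))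
    (hEBlo : TubeFloorGB (famAnd (famAndNot (famAnd 𝓘 (Dense dA)) 𝓡) (Dense dB)) (1 / 25) (constTol (1 / 25)) (relConeBy 2 βf₂ sf₂ (1 / 25)))
    (hEBhi : TubeFloorGB (famAndNot (famAndNot (famAnd 𝓘 (Dense dA)) 𝓡) (Dense dB)) (1 / 25) (constTol (1 / 25)) (relConeBy 2 βf₃ sf₃ (1 / 25)))
    (hEA : TubeFloor (famAndNot 𝓘 (Dense dA)) (1 / 25))
    (hK : FamilyCoverGRecAt 𝓘₀ (26 / 5) (1 / 100))
    (h𝓗D : FamilyLE (famAnd (famAnd 𝓘₀ (Dense dA)) 𝓡) 𝓗)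
    (hXD : SlavingEnclosureG (famAnd (famAnd 𝓘₀ (Dense dA)) 𝓡) balTop (26 / 5) (1 / 100) (1 / 8) (1 / 25) (constTol (1 / 25)) κ σ H F X)
    (hPD : PairKernelCert (famAnd (famAnd 𝓘₀ (Dense dA)) 𝓡) balTop (1 / 25) (constTol (1 / 25)) κ σ H F X (1 / 25) (constTol (1 / 25))
      (relConeBy 2 βf₁ sf₁ (1 / 25)))
    (h𝓗Blo : FamilyLE (famAnd (famAndNot (famAnd 𝓘₀ (Dense dA)) 𝓡) (Dense dB)) 𝓗)
    (hXBlo : SlavingEnclosureG (famAnd (famAndNot (famAnd 𝓘₀ (Dense dA)) 𝓡) (Dense dB)) balTop (26 / 5) (1 / 100) (1 / 8) (1 / 25) (constTol (1 / 25)) κ' σ' H' F' X')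
    (hPBlo : PairKernelCert (famAnd (famAndNot (famAnd 𝓘₀ (Dense dA)) 𝓡) (Dense dB)) balTop (1 / 25) (constTol (1 / 25)) κ' σ' H' F' X' (1 / 25) (constTol (1 / 25))
      (relConeBy 2 βf₂ sf₂ (1 / 25)))
    (hNBhi : RefineGB (famAndNot (famAndNot (famAnd 𝓘₀ (Dense dA)) 𝓡) (Dense dB)) 𝓗 (26 / 5) (1 / 100) (1 / 8) (1 / 25) (constTol (1 / 25)) (1 / 25)
      (constTol (1 / 25)) (relConeBy 2 (stepByF 𝓡 βf₁ (stepByF (Dense dB) βf₂ βf₃)) (stepByF 𝓡 sf₁ (stepByF (Dense dB) sf₂ sf₃)) (1 / 25)))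
    (h𝓗 : FamilyLE (famAndNot 𝓘₀ (Dense dA)) 𝓗)
    (hcap : PairLE (relConeBy 2 (stepByF 𝓡 βf₁ (stepByF (Dense dB) βf₂ βf₃)) (stepByF 𝓡 sf₁ (stepByF (Dense dB) sf₂ sf₃)) (1 / 25)) (pairSum (constTol (1 / 25))))
    (h𝓘 : FamilyLE 𝓗 𝓘)
    (hF : AnnularPhaseFloor (63 / 10) (24 / 5) (63 / 10) (1 / 1000)) (hP : PolyTextureFloor (63 / 10) (24 / 5) (1 / 1000))
    (hA : AnnularDefectFloor (24 / 5) (63 / 10)) (hD : DefectiveCollarFloor (24 / 5))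
    (h2 : CrowdedCoreMotifPricingCapK (1 / 1000) (9 / 5) (133 / 10) (3 / 2) (effPot w₄₅ ω₄ (3 / 400)) (-(7175 / 10000) + 3 / 400)
      (Collar (9 / 2) fun N y j => (∃ s : ℝ, 0 ≤ s ∧ s ≤ 3 / 2 ∧ NonEquilibriumCore (-(7175 / 10000)) 0 7 s (1 / 10000) N y j) ∨
        GoodAtScale (1 / 20) (3 / 2) y j))
    (h3 : DiluteDefectMotifPricingCapK (1 / 1000) (9 / 5) (133 / 10) (3 / 2) (effPot w₄₅ ω₄ (3 / 400)) (-(7175 / 10000) + 3 / 400)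
      (Collar (9 / 2) fun N y j => (∃ s : ℝ, 0 ≤ s ∧ s ≤ 3 / 2 ∧ NonEquilibriumCore (-(7175 / 10000)) 0 7 s (1 / 10000) N y j) ∨
        GoodAtScale (1 / 20) (3 / 2) y j)) :
    Summit.AtomisticToContinuum.Crystallization.Theses.FrustratedLawDichotomy.AperiodicFrustratedLawGap :=
  aperiodicFrustratedLawGap_of_fourSector_A35000_T26_record hε0 hε1 hDX hEl hFcc hHcp hT hRl hED hEBlo hEBhi hEA hK
    (refineGB_ND_of_kernelCut_top (βf₂ := stepByF (Dense dB) βf₂ βf₃) (sf₂ := stepByF (Dense dB) sf₂ sf₃) h𝓗D hXD hPD)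
    (refineGB_NBlo_of_kernelCut_top h𝓗Blo hXBlo hPBlo) hNBhi h𝓗 hcap h𝓘 hF hP hA hD h2 h3

end FourSector

/-! ## §3. The record instance: `𝓡 := ShearDoorGram (24/25) (9/100) bends0 ν μ δ νh μh δh`, `dA = 26/25`, `dB = 1009/1000` (window literals still generic;
bending class of record `bends0` — a census-narrowed `polyBends q₂′ q₃′` is the same theorem re-instantiated) -/

section Record

variable {𝓘₀ 𝓗 𝓘 : ChartFam} {ν μ δ νh μh δh : ℝ} {βf₁ βf₂ βf₃ sf₁ sf₂ sf₃ : (M₀ : ℕ) → (Fin M₀ → E3) → Fin M₀ → ℝ}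

/-- ★★★ **THE CRUX BY NAME AT THE SHEAR-AWARE DOOR OF RECORD SHAPE** — the eight cells of SECTOR-97: (E|𝔇′) `hED`, (E|𝔅lo) `hEBlo`, (E|𝔅hi) `hEBhi`, (E|𝔄) `hEA`,
(N|𝔇′) `hND`, (N|𝔅lo) `hNBlo`, (N|𝔅hi) `hNBhi`, (N|𝔄) free; door `ShearDoorGram (24/25) (9/100) bends0 ν μ δ νh μh δh` (bending class of record), thresholds
`dA = 26/25`, `dB = 1009/1000`. [folklore instantiation] -/
theorem aperiodicFrustratedLawGap_of_fourSector_shearDoor_record {εE CE DE DX : ℝ}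
    (hε0 : 0 < εE) (hε1 : εE ≤ 1 / 10000) (hDX : 0 ≤ DX)
    (hEl : SchurElasticPricingX (1 / 20) (1 / 8) w₄₅ ω₄ (3 / 400) (-(7175 / 10000)) (1 / 10000) CE DE DX (LocOptFails eStar εE (3 / 2) 1))
    (hFcc : ∃ t : CertTree (Fin 3 × Fin 3), treeOK (entryLeafOK6RBKP4 (-399210329969189)) t rootC rootW = true)
    (hHcp : semOKH (-399210329969189) rootCH rootWH = true)
    (hT : ∀ (M : ℕ) (z : Fin M → E3) (c : Fin M), Admissible M z c → CleanBall (63 / 10) z c → MonoPhaseBall (63 / 10) z c →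
      NearHomIsoAt (26 / 5) (1 / 100) z c → -(13 / 50000) ≤ ballAvg (9 / 5) z (tailOut (26 / 5) M z c) c)
    (hRl : CoreCoreRelief (63 / 10) (63 / 10) (26 / 5) (1 / 100) (3 / 5000))
    (hED : TubeFloorGB (famAnd (famAnd 𝓘 (Dense (26 / 25))) (ShearDoorGram (24 / 25) (9 / 100) bends0 ν μ δ νh μh δh)) (1 / 25) (constTol (1 / 25))
      (relConeBy 2 βf₁ sf₁ (1 / 25)))
    (hEBlo : TubeFloorGB (famAnd (famAndNot (famAnd 𝓘 (Dense (26 / 25))) (ShearDoorGram (24 / 25) (9 / 100) bends0 ν μ δ νh μh δh)) (Dense (1009 / 1000)))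
      (1 / 25) (constTol (1 / 25)) (relConeBy 2 βf₂ sf₂ (1 / 25)))
    (hEBhi : TubeFloorGB (famAndNot (famAndNot (famAnd 𝓘 (Dense (26 / 25))) (ShearDoorGram (24 / 25) (9 / 100) bends0 ν μ δ νh μh δh)) (Dense (1009 / 1000)))
      (1 / 25) (constTol (1 / 25)) (relConeBy 2 βf₃ sf₃ (1 / 25)))
    (hEA : TubeFloor (famAndNot 𝓘 (Dense (26 / 25))) (1 / 25))
    (hK : FamilyCoverGRecAt 𝓘₀ (26 / 5) (1 / 100))
    (hND : RefineGB (famAnd (famAnd 𝓘₀ (Dense (26 / 25))) (ShearDoorGram (24 / 25) (9 / 100) bends0 ν μ δ νh μh δh)) 𝓗 (26 / 5) (1 / 100) (1 / 8) (1 / 25)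
      (constTol (1 / 25)) (1 / 25) (constTol (1 / 25))
      (relConeBy 2 (stepByF (ShearDoorGram (24 / 25) (9 / 100) bends0 ν μ δ νh μh δh) βf₁ (stepByF (Dense (1009 / 1000)) βf₂ βf₃))
        (stepByF (ShearDoorGram (24 / 25) (9 / 100) bends0 ν μ δ νh μh δh) sf₁ (stepByF (Dense (1009 / 1000)) sf₂ sf₃)) (1 / 25)))
    (hNBlo : RefineGB (famAnd (famAndNot (famAnd 𝓘₀ (Dense (26 / 25))) (ShearDoorGram (24 / 25) (9 / 100) bends0 ν μ δ νh μh δh)) (Dense (1009 / 1000))) 𝓗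
      (26 / 5) (1 / 100) (1 / 8) (1 / 25) (constTol (1 / 25)) (1 / 25) (constTol (1 / 25))
      (relConeBy 2 (stepByF (ShearDoorGram (24 / 25) (9 / 100) bends0 ν μ δ νh μh δh) βf₁ (stepByF (Dense (1009 / 1000)) βf₂ βf₃))
        (stepByF (ShearDoorGram (24 / 25) (9 / 100) bends0 ν μ δ νh μh δh) sf₁ (stepByF (Dense (1009 / 1000)) sf₂ sf₃)) (1 / 25)))
    (hNBhi : RefineGB (famAndNot (famAndNot (famAnd 𝓘₀ (Dense (26 / 25))) (ShearDoorGram (24 / 25) (9 / 100) bends0 ν μ δ νh μh δh)) (Dense (1009 / 1000))) 𝓗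
      (26 / 5) (1 / 100) (1 / 8) (1 / 25) (constTol (1 / 25)) (1 / 25) (constTol (1 / 25))
      (relConeBy 2 (stepByF (ShearDoorGram (24 / 25) (9 / 100) bends0 ν μ δ νh μh δh) βf₁ (stepByF (Dense (1009 / 1000)) βf₂ βf₃))
        (stepByF (ShearDoorGram (24 / 25) (9 / 100) bends0 ν μ δ νh μh δh) sf₁ (stepByF (Dense (1009 / 1000)) sf₂ sf₃)) (1 / 25)))
    (h𝓗 : FamilyLE (famAndNot 𝓘₀ (Dense (26 / 25))) 𝓗)
    (hcap : PairLE (relConeBy 2 (stepByF (ShearDoorGram (24 / 25) (9 / 100) bends0 ν μ δ νh μh δh) βf₁ (stepByF (Dense (1009 / 1000)) βf₂ βf₃))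
      (stepByF (ShearDoorGram (24 / 25) (9 / 100) bends0 ν μ δ νh μh δh) sf₁ (stepByF (Dense (1009 / 1000)) sf₂ sf₃)) (1 / 25)) (pairSum (constTol (1 / 25))))
    (h𝓘 : FamilyLE 𝓗 𝓘)
    (hF : AnnularPhaseFloor (63 / 10) (24 / 5) (63 / 10) (1 / 1000)) (hP : PolyTextureFloor (63 / 10) (24 / 5) (1 / 1000))
    (hA : AnnularDefectFloor (24 / 5) (63 / 10)) (hD : DefectiveCollarFloor (24 / 5))
    (h2 : CrowdedCoreMotifPricingCapK (1 / 1000) (9 / 5) (133 / 10) (3 / 2) (effPot w₄₅ ω₄ (3 / 400)) (-(7175 / 10000) + 3 / 400)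
      (Collar (9 / 2) fun N y j => (∃ s : ℝ, 0 ≤ s ∧ s ≤ 3 / 2 ∧ NonEquilibriumCore (-(7175 / 10000)) 0 7 s (1 / 10000) N y j) ∨
        GoodAtScale (1 / 20) (3 / 2) y j))
    (h3 : DiluteDefectMotifPricingCapK (1 / 1000) (9 / 5) (133 / 10) (3 / 2) (effPot w₄₅ ω₄ (3 / 400)) (-(7175 / 10000) + 3 / 400)
      (Collar (9 / 2) fun N y j => (∃ s : ℝ, 0 ≤ s ∧ s ≤ 3 / 2 ∧ NonEquilibriumCore (-(7175 / 10000)) 0 7 s (1 / 10000) N y j) ∨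
        GoodAtScale (1 / 20) (3 / 2) y j)) :
    Summit.AtomisticToContinuum.Crystallization.Theses.FrustratedLawDichotomy.AperiodicFrustratedLawGap :=
  aperiodicFrustratedLawGap_of_fourSector_A35000_T26_record hε0 hε1 hDX hEl hFcc hHcp hT hRl hED hEBlo hEBhi hEA hK hND hNBlo hNBhi h𝓗 hcap h𝓘 hF hP hA
    hD h2 h3

end Record

end Summit.AtomisticToContinuum.Crystallization.Theorems.FrustratedLawDichotomyStrainedPatchShearDoor
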